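import Mathlib.Probability.BrownianMotion.Basic
import HarnessLib

/-!
# Time reversal of Brownian motion at a fixed time

Topic `Probability/Process`; theorems only. For a (pre-)Brownian motion `B` on `(Ω, P)` and a
fixed time `t ≥ 0`, the process

  `s ↦ B (t - s) + B (max t s) - 2 B t`

(truncated subtraction in `ℝ≥0`), which is the **time reversal** `s ↦ B (t - s) - B t` on `[0, t]`
continued after time `t` by the original increments (`s ↦ B s - 2 B t + B 0` for `s ≥ t`), is
again a (pre-)Brownian motion (`IsPreBrownianReal.reverse`, `IsBrownianReal.reverse`); its paths
are continuous whenever those of `B` are (`continuous_reverse`). This is the Brownian input of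
Rohde–Schramm's Lemma 3.1 (*Basic properties of SLE*, Ann. Math. 161 (2005), p. 889: "Then
`ξ̂_{t₁} : ℝ → ℝ` has the same law as `ξ : ℝ → ℝ`", for the two-sided driving Brownian motion read
backwards from `t₁`), in the one-sided form needed to identify the law of `f̂ₜ - ξ(t)` with that of
the backward SLE flow at time `t`. Proof: the new process is a centred Gaussian process (each value
is a linear combination of three values of `B`, Mathlib `IsGaussianProcess.of_isGaussianProcess`)
with covariance `min` (a three-case computation), hence pre-Brownian by Mathlib's
`IsGaussianProcess.isPreBrownianReal_of_covariance`.

Mathlib has the analogous invariances `IsPreBrownianReal.neg/smul/shift/inv` but not time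
reversal (searched `BrownianMotion/Basic.lean`).

## References

* S. Rohde, O. Schramm, *Basic properties of SLE*, Ann. of Math. 161 (2005), Lemma 3.1.
* D. Revuz, M. Yor, *Continuous Martingales and Brownian Motion* (3rd ed., 1999), Ch. I,
  Ex. (1.11) 1° (time inversion / reversal invariances of Brownian motion).
-/

noncomputable section

open MeasureTheory ProbabilityTheory
open scoped NNReal

namespace Literature.Probability.Process

variable {Ω : Type*} {mΩ : MeasurableSpace Ω} {B : ℝ≥0 → Ω → ℝ} {P : Measure Ω}

/-- On `[0, t]` the reversed process is `B (t - s) - B t`. [folklore] -/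
theorem reverse_apply_of_le {s t : ℝ≥0} (h : s ≤ t) (ω : Ω) :
    B (t - s) ω + B (max t s) ω - 2 * B t ω = B (t - s) ω - B t ω := by
  rw [max_eq_left h]
  ring

/-- After `t` the reversed process is `B s - 2 B t + B 0`. [folklore] -/
theorem reverse_apply_of_ge {s t : ℝ≥0} (h : t ≤ s) (ω : Ω) :
    B (t - s) ω + B (max t s) ω - 2 * B t ω = B s ω - 2 * B t ω + B 0 ω := by
  rw [max_eq_right h, tsub_eq_zero_of_le h]
  ring

/-- At `s = 0` the reversed process vanishes (identically). [folklore] -/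
theorem reverse_apply_zero (B : ℝ≥0 → Ω → ℝ) (t : ℝ≥0) (ω : Ω) :
    B (t - 0) ω + B (max t 0) ω - 2 * B t ω = 0 := by
  rw [tsub_zero, max_eq_left zero_le]
  ring

/-- The reversed process has continuous paths when `B` has. [folklore] -/
theorem continuous_reverse {ω : Ω} (h : Continuous (B · ω)) (t : ℝ≥0) :
    Continuous fun s ↦ B (t - s) ω + B (max t s) ω - 2 * B t ω := by
  have h1 : Continuous fun s : ℝ≥0 ↦ B (t - s) ω :=
    h.comp (continuous_const.sub continuous_id)
  have h2 : Continuous fun s : ℝ≥0 ↦ B (max t s) ω := h.comp (continuous_const.max continuous_id)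
  exact (h1.add h2).sub continuous_const

section Covariance

variable (hB : IsPreBrownianReal B P)
include hB

omit hB in
/-- The reversed process as a combination of processes (`Pi` arithmetic). [folklore] -/
theorem reverse_eq_pi (B : ℝ≥0 → Ω → ℝ) (s t : ℝ≥0) :
    (fun ω ↦ B (t - s) ω + B (max t s) ω - 2 * B t ω) = B (t - s) + B (max t s) - (2 : ℝ) • B t := by
  ext ω
  simp [smul_eq_mul]

/-- The covariance of a value of the reversed process with a value of `B`:
`cov(B(t-s) + B(t ∨ s) - 2Bₜ, Bᵤ) = (t-s) ∧ u + (t ∨ s) ∧ u - 2 (t ∧ u)`. [folklore] -/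
theorem covariance_reverse_eval (s t u : ℝ≥0) :
    cov[fun ω ↦ B (t - s) ω + B (max t s) ω - 2 * B t ω, B u; P] =
      (min (t - s) u : ℝ≥0) + (min (max t s) u : ℝ≥0) - 2 * (min t u : ℝ≥0) := by
  have := hB.isGaussianProcess.isProbabilityMeasure
  have hL : ∀ r, MemLp (B r) 2 P := fun r ↦ (hB.isGaussianProcess.hasGaussianLaw_eval r).memLp_two
  have h2 : MemLp ((2 : ℝ) • B t) 2 P := (hL t).const_smul 2
  rw [reverse_eq_pi, covariance_sub_left ((hL _).add (hL _)) h2 (hL u),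
    covariance_add_left (hL _) (hL _) (hL u), covariance_smul_left, hB.covariance_eval,
    hB.covariance_eval, hB.covariance_eval]

/-- **The covariance of the reversed process is `min`**: for `s ≤ s'`,
`cov(R s, R s') = s` where `R s = B (t - s) + B (t ∨ s) - 2 Bₜ`. [folklore] -/
theorem covariance_reverse {s s' : ℝ≥0} (hss' : s ≤ s') (t : ℝ≥0) :
    cov[fun ω ↦ B (t - s) ω + B (max t s) ω - 2 * B t ω,
      fun ω ↦ B (t - s') ω + B (max t s') ω - 2 * B t ω; P] = s := by
  have := hB.isGaussianProcess.isProbabilityMeasure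
  have hL : ∀ r, MemLp (B r) 2 P := fun r ↦ (hB.isGaussianProcess.hasGaussianLaw_eval r).memLp_two
  have hR : MemLp (fun ω ↦ B (t - s) ω + B (max t s) ω - 2 * B t ω) 2 P := by
    rw [reverse_eq_pi]
    exact ((hL _).add (hL _)).sub ((hL t).const_smul 2)
  have h2 : MemLp ((2 : ℝ) • B t) 2 P := (hL t).const_smul 2
  rw [reverse_eq_pi B s' t, covariance_sub_right hR ((hL _).add (hL _)) h2,
    covariance_add_right hR (hL _) (hL _), covariance_smul_right, covariance_reverse_eval hB,
    covariance_reverse_eval hB, covariance_reverse_eval hB]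
  -- the three cases `s ≤ s' ≤ t`, `s ≤ t ≤ s'`, `t ≤ s ≤ s'`
  rcases le_total s' t with hs't | hts'
  · have hst : s ≤ t := hss'.trans hs't
    have e1 : min (t - s) (t - s') = t - s' := min_eq_right (tsub_le_tsub_left hss' t)
    have e2 : min (max t s) (t - s') = t - s' := by rw [max_eq_left hst]; exact min_eq_right tsub_le_self
    have e3 : min t (t - s') = t - s' := min_eq_right tsub_le_self
    have e4 : min (t - s) (max t s') = t - s := by rw [max_eq_left hs't]; exact min_eq_left tsub_le_self
    have e5 : min (max t s) (max t s') = t := by rw [max_eq_left hst, max_eq_left hs't, min_self]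
    have e6 : min t (max t s') = t := by rw [max_eq_left hs't, min_self]
    have e7 : min (t - s) t = t - s := min_eq_left tsub_le_self
    have e8 : min (max t s) t = t := by rw [max_eq_left hst, min_self]
    have e9 : min t t = t := min_self t
    rw [e1, e2, e3, e4, e5, e6, e7, e8, e9, NNReal.coe_sub hst]
    ring
  · rcases le_total s t with hst | hts
    · have e0 : t - s' = 0 := tsub_eq_zero_of_le hts'
      have e1 : min (t - s) (t - s') = 0 := by rw [e0, min_eq_right zero_le]
      have e2 : min (max t s) (t - s') = 0 := by rw [e0, min_eq_right zero_le]
      have e3 : min t (t - s') = 0 := by rw [e0, min_eq_right zero_le]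
      have e4 : min (t - s) (max t s') = t - s := by
        rw [max_eq_right hts']; exact min_eq_left (tsub_le_self.trans hts')
      have e5 : min (max t s) (max t s') = t := by
        rw [max_eq_left hst, max_eq_right hts']; exact min_eq_left hts'
      have e6 : min t (max t s') = t := by rw [max_eq_right hts']; exact min_eq_left hts'
      have e7 : min (t - s) t = t - s := min_eq_left tsub_le_self
      have e8 : min (max t s) t = t := by rw [max_eq_left hst, min_self]
      have e9 : min t t = t := min_self t
      rw [e1, e2, e3, e4, e5, e6, e7, e8, e9, NNReal.coe_sub hst]
      push_cast
      ring
    · have hts' : t ≤ s' := hts.trans hss'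
      have e0 : t - s' = 0 := tsub_eq_zero_of_le hts'
      have e0' : t - s = 0 := tsub_eq_zero_of_le hts
      have e1 : min (t - s) (t - s') = 0 := by rw [e0, min_eq_right zero_le]
      have e2 : min (max t s) (t - s') = 0 := by rw [e0, min_eq_right zero_le]
      have e3 : min t (t - s') = 0 := by rw [e0, min_eq_right zero_le]
      have e4 : min (t - s) (max t s') = 0 := by rw [e0', min_eq_left zero_le]
      have e5 : min (max t s) (max t s') = s := by
        rw [max_eq_right hts, max_eq_right hts']; exact min_eq_left hss'
      have e6 : min t (max t s') = t := by rw [max_eq_right hts']; exact min_eq_left hts'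
      have e7 : min (t - s) t = 0 := by rw [e0', min_eq_left zero_le]
      have e8 : min (max t s) t = t := by rw [max_eq_right hts]; exact min_eq_right hts
      have e9 : min t t = t := min_self t
      rw [e1, e2, e3, e4, e5, e6, e7, e8, e9]
      push_cast
      ring

end Covariance

/-- **Time reversal of a pre-Brownian motion is a pre-Brownian motion**: for every `t ≥ 0`,
`s ↦ B (t - s) + B (t ∨ s) - 2 Bₜ` (`= B (t - s) - Bₜ` on `[0, t]`, continued by the increments of
`B` after `t`) has the finite-dimensional laws of Brownian motion. Rohde–Schramm (2005), Lemma 3.1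
("`ξ̂_{t₁}` has the same law as `ξ`"). [cite: RohdeSchramm2005, Lemma 3.1] -/
theorem _root_.ProbabilityTheory.IsPreBrownianReal.reverse (hB : IsPreBrownianReal B P) (t : ℝ≥0) :
    IsPreBrownianReal (fun s ω ↦ B (t - s) ω + B (max t s) ω - 2 * B t ω) P := by
  have := hB.isGaussianProcess.isProbabilityMeasure
  classical
  refine IsGaussianProcess.isPreBrownianReal_of_covariance ?_ (fun s ↦ ?_) (fun s s' hss' ↦ ?_)
  · exact hB.isGaussianProcess.of_isGaussianProcess fun s ↦ ⟨{t - s, max t s, t},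
      { toFun := fun x ↦ x ⟨t - s, by simp⟩ + x ⟨max t s, by simp⟩ - 2 * x ⟨t, by simp⟩
        map_add' := fun x y ↦ by simp; ring
        map_smul' := fun c x ↦ by simp; ring },
      fun ω ↦ by simp⟩
  · have hi : ∀ r, Integrable (B r) P := hB.integrable_eval
    have h12 : Integrable (fun ω ↦ B (t - s) ω + B (max t s) ω) P := (hi _).add (hi _)
    have h3 : Integrable (fun ω ↦ 2 * B t ω) P := (hi t).const_mul 2
    rw [integral_sub h12 h3, integral_add (hi _) (hi _), integral_const_mul, hB.integral_eval,
      hB.integral_eval, hB.integral_eval]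
    ring
  · exact Literature.Probability.Process.covariance_reverse hB hss' t

/-- **Time reversal of a Brownian motion is a Brownian motion** (a.s. continuous paths are
reversed into a.s. continuous paths). Rohde–Schramm (2005), Lemma 3.1. [cite: RohdeSchramm2005, Lemma 3.1] -/
theorem _root_.ProbabilityTheory.IsBrownianReal.reverse (hB : IsBrownianReal B P) (t : ℝ≥0) :
    IsBrownianReal (fun s ω ↦ B (t - s) ω + B (max t s) ω - 2 * B t ω) P where
  toIsPreBrownianReal := hB.toIsPreBrownianReal.reverse t
  cont := by
    filter_upwards [hB.cont] with ω hω
    exact continuous_reverse hω t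

/-- The marginals of the reversed process are measurable when those of `B` are. [folklore] -/
theorem measurable_reverse (hm : ∀ r, Measurable (B r)) (t s : ℝ≥0) :
    Measurable fun ω ↦ B (t - s) ω + B (max t s) ω - 2 * B t ω :=
  ((hm _).add (hm _)).sub ((hm t).const_mul 2)

end Literature.Probability.Process
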